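import Summits.BirchSwinnertonDyer.BirchSwinnertonDyer.Theorems.ResidualThetaTransportAtTwoSignedMuVanishingAtTwoPlusMultOneOldFamilyPrimeSq
import Summits.BirchSwinnertonDyer.BirchSwinnertonDyer.Theorems.ByReductionTypeAtTwoSupersingularUnitAnchorClass347361g
import HarnessLib
-- buildfix (bf3-g30) G30-13: comment-only touch to re-dispatch the lane build (dead-lettered rc 76 ×7 behind Theorems.ByReductionTypeAtTwoSupersingularThetaHabitat, which bf3-g29 re-glued p635943 (hub olean 13:14); no build event since 12:21; operator express ask 14:2x unserved); declarations byte-identical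

/-!
# Route `ResidualThetaTransportAtTwo`, crux Kμ⁺ `SignedMuVanishingAtTwoPlus` (stmt-BirchSwinnertonDyer-20689), line
# `birth`, stub `stub_flatMuZeroAtTwo`: CLASS INSTANCE — FLAT at `2` AT the crux-scope class **347361g1** (`N = 3·17·7²·139`,
# anchor `51a1`, pattern `N₀·q·ℓ²` with `N₀ = 51`, `q = 139`, `ℓ = 7`) from four named print facts, kernel certificates, Cremona
# parities and ONE `L`-value certificate

Cell `bsd-wall`, width seat `bsd-wall-rtt-p4-w2` (g4). THEOREMS ONLY; helper `--supports` the crux; an INSTANCE, not a booking;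
closes nothing. BSD is not proved by this. `347361g1` is in the scope of the crux (no CM, analytic rank `0`, good supersingular at
`2` with `a₂ = 0`, `Δ < 0`; kernel facts of `SSColemanRoad`).

## What is proved
`flatAtTwo_347361g1`: for `W = 347361g1 = [0,-1,1,-32210705,-70352938111]` and its newform `f`: `2 ∤ L♭` for every Pollack pair
`(L♯, L♭)` of `f` at `2`, GRANTED:
* named print facts: `buzzard2000_multiplicityOne_gamma0`, `serre1972_supersingular_decompositionSubgroup_image`,
  `heckeSelfDual_torsionBy_J0`, `mazurKenku_exists_cyclic_isogeny`;
* displayed certificates (Cremona's Table 1): conductors `N(347361g1) = 347361`, `N(51a1) = 51`; parities: `a₃, a₁₇, a₁₃₉` of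
  `347361g1` odd (multiplicative; `= −1, −1, −1`), `a₇(347361g1) = 0` even (additive); `a₃, a₁₇` of `51a1` odd (multiplicative;
  `= 1, −1`), `a₁₃₉(51a1) = 2`, `a₇(51a1) = −4` even; the `L`-value `L(51a1,1)/Ω⁺ = [0]⁺ = 1/3` (`#tors = 3`, `∏c_p = 3`,
  `#Ш_an = 1`);
* KERNEL: `347361g1` good supersingular at `2` with `a₂ = 0`, `Δ < 0` (`SSColemanRoad`); `51a1` good supersingular at `2` with
  `a₂ = 0` (`SSUnitAnchor`); `347361g1[2] ≅ 51a1[2]` (`SSUnitAnchor.twoTorsion_congruent_347361g1_ua51a1`, Tschirnhaus certificate);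
  the old family at level `51·139·7²` and its `U_p`-bookkeeping (`…MultOneOldFamilyPrimeSq`); the layer-`0` certificate
  `(a₂−3)(a₂+1)[0]⁺ = −1` odd (`…OldClassFlat.exists_odd_of_layerZero`).

References: [CremonaAlgorithms1997] Table 1 (347361g1, 51a1); [Buzzard2000LevelLoweringModTwo] Prop. 2.4; [SerreInventiones1972]
Prop. 12; [DarmonDiamondTaylor1995] Lemma 1.38; [Mazur1978]; [EmertonPollackWeston2006] §4.4; [Pollack2003] Conj. 6.3.
-/

set_option autoImplicit false
set_option linter.dupNamespace false

noncomputable section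

open scoped Classical MatrixGroups ModularForm

open CongruenceSubgroup Field WeierstrassCurve Literature.NumberTheory.EllipticCurves
  Literature.NumberTheory.EllipticCurves.ModularForms Literature.NumberTheory.EllipticCurves.Rank1Residual
  Literature.NumberTheory.IwasawaTheory Summit.BirchSwinnertonDyer.Rank1Residual.Supersingular
  Summit.BirchSwinnertonDyer.BirchSwinnertonDyer.Theses.ResidualThetaTransportAtTwo

namespace Summit.BirchSwinnertonDyer.BirchSwinnertonDyer.Theorems.SignedMuAtTwo

namespace MultOneDictionary

/-- **FLAT at `2` AT `347361g1` (anchor `51a1`), from four named facts, kernel certificates, parities and ONE `L`-value.** See the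
module docstring for the exact displayed inputs. [cite: CremonaAlgorithms1997, Table 1] [cite: Buzzard2000LevelLoweringModTwo, Prop. 2.4]
[cite: DarmonDiamondTaylor1995, §1.6 Lemma 1.38] [cite: SerreInventiones1972, §1.11 Prop. 12] [cite: Mazur1978, Thm. 1]
[cite: EmertonPollackWeston2006, §4.4] [cite: Pollack2003, Conj. 6.3 and Prop. 6.18] -/
theorem flatAtTwo_347361g1 (hBuz : buzzard2000_multiplicityOne_gamma0)
    (hSe : serre1972_supersingular_decompositionSubgroup_image) (hSD : heckeSelfDual_torsionBy_J0)
    (hMK : mazurKenku_exists_cyclic_isogeny)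
    [((⟨0, -1, 1, -32210705, -70352938111⟩ : WeierstrassCurve ℤ).baseChange ℚ).IsElliptic] [((⟨0, -1, 1, -32210705, -70352938111⟩ : WeierstrassCurve ℤ).baseChange ℚ).IsGloballyMinimal]
    [((⟨0, 1, 1, 1, -1⟩ : WeierstrassCurve ℤ).baseChange ℚ).IsElliptic] [((⟨0, 1, 1, 1, -1⟩ : WeierstrassCurve ℤ).baseChange ℚ).IsGloballyMinimal]
    -- displayed certificates (Cremona Table 1)
    (hNW : ((⟨0, -1, 1, -32210705, -70352938111⟩ : WeierstrassCurve ℤ).baseChange ℚ).conductorNorm ℤ = 347361)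
    (hNA : ((⟨0, 1, 1, 1, -1⟩ : WeierstrassCurve ℤ).baseChange ℚ).conductorNorm ℤ = 51)
    (hW3 : Odd (((⟨0, -1, 1, -32210705, -70352938111⟩ : WeierstrassCurve ℤ).baseChange ℚ).LFunction 3)) (hW17 : Odd (((⟨0, -1, 1, -32210705, -70352938111⟩ : WeierstrassCurve ℤ).baseChange ℚ).LFunction 17))
    (hW139 : Odd (((⟨0, -1, 1, -32210705, -70352938111⟩ : WeierstrassCurve ℤ).baseChange ℚ).LFunction 139)) (hW7 : Even (((⟨0, -1, 1, -32210705, -70352938111⟩ : WeierstrassCurve ℤ).baseChange ℚ).LFunction 7))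
    (hA3 : Odd (((⟨0, 1, 1, 1, -1⟩ : WeierstrassCurve ℤ).baseChange ℚ).LFunction 3)) (hA17 : Odd (((⟨0, 1, 1, 1, -1⟩ : WeierstrassCurve ℤ).baseChange ℚ).LFunction 17))
    (hA139 : Even (((⟨0, 1, 1, 1, -1⟩ : WeierstrassCurve ℤ).baseChange ℚ).LFunction 139)) (hA7 : Even (((⟨0, 1, 1, 1, -1⟩ : WeierstrassCurve ℤ).baseChange ℚ).LFunction 7))
    [NeZero (((⟨0, -1, 1, -32210705, -70352938111⟩ : WeierstrassCurve ℤ).baseChange ℚ).conductorNorm ℤ)]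
    (f : CuspForm (Gamma0 (((⟨0, -1, 1, -32210705, -70352938111⟩ : WeierstrassCurve ℤ).baseChange ℚ).conductorNorm ℤ)) 2) (hf : IsNewformOf ((⟨0, -1, 1, -32210705, -70352938111⟩ : WeierstrassCurve ℤ).baseChange ℚ) f)
    (g : CuspForm (Gamma0 51) 2) (hg : IsNewformOf ((⟨0, 1, 1, 1, -1⟩ : WeierstrassCurve ℤ).baseChange ℚ) g)
    (hL : ratPlusSymbol g 0 = 1 / 3) :
    ∀ Lplus Lminus : IwasawaAlgebra 2, IsPollackPair f 2 Lplus Lminus → ¬ PowerSeries.C (2 : ℤ_[2]) ∣ Lminus := by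
  have hE := SSColemanRoad.goodSS_two_347361g1
  have hA := SSUnitAnchor.goodSS_two_ua51a1
  have hΔ : ((⟨0, -1, 1, -32210705, -70352938111⟩ : WeierstrassCurve ℤ).baseChange ℚ).Δ < 0 := by
    rw [baseChange_int_Δ, SSColemanRoad.M347361g1_Δ]; norm_num
  obtain ⟨e, he⟩ := SSUnitAnchor.twoTorsion_congruent_347361g1_ua51a1
  have hAf : ∀ p : ℕ, p.Prime → cuspCoeff f p = (((((⟨0, -1, 1, -32210705, -70352938111⟩ : WeierstrassCurve ℤ).baseChange ℚ).LFunction p : ℤ)) : ℂ) := fun p _ ↦ hf.2 p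
  have hBg : ∀ p : ℕ, p.Prime → cuspCoeff g p = (((((⟨0, 1, 1, 1, -1⟩ : WeierstrassCurve ℤ).baseChange ℚ).LFunction p : ℤ)) : ℂ) := fun p _ ↦ hg.2 p
  have hA2 : ((⟨0, 1, 1, 1, -1⟩ : WeierstrassCurve ℤ).baseChange ℚ).LFunction 2 = 0 := by
    rw [LFunction_apply_prime_eq_frobeniusTrace _ 2 hA.1, hA.2.1]
  -- the residual certificate: `(a₂ − 3)(a₂ + 1)[0]⁺ = −1`
  have hres : ∃ k : ℕ, 1 ≤ k ∧ ∃ b : ℤ, Odd b ∧ ∃ m : ℤ, Odd m ∧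
      ratPlusSymbol g ((b : ℚ) / 4 ^ k) = ratPlusSymbol g 0 + (m : ℚ) / 2 := by
    refine exists_odd_of_layerZero g hg.1 (by decide) (a := 0) (by simp [hg.2 2, hA2]) (m := -1) (by decide) ?_
    norm_num [hL]
  have hN : 51 * (139 * 7 ^ 2) = ((⟨0, -1, 1, -32210705, -70352938111⟩ : WeierstrassCurve ℤ).baseChange ℚ).conductorNorm ℤ := by
    norm_num [hNW]
  have hNA' : ((⟨0, 1, 1, 1, -1⟩ : WeierstrassCurve ℤ).baseChange ℚ).conductorNorm ℤ ∣ ((⟨0, -1, 1, -32210705, -70352938111⟩ : WeierstrassCurve ℤ).baseChange ℚ).conductorNorm ℤ := by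
    rw [hNA, hNW]; norm_num
  -- two odd integers agree mod 2
  have hodd : ∀ a b : ℤ, Odd a → Odd b → ((a : ℤ) : ZMod 2) = ((b : ℤ) : ZMod 2) := by
    rintro a b ⟨c, rfl⟩ ⟨d, rfl⟩
    push_cast
    have h2 : (2 : ZMod 2) = 0 := by decide
    rw [h2, zero_mul, zero_mul]
  refine flatAtTwo_turnkey_prime_sq_level hBuz hSe hSD hMK hE.2.2 hE.2.1 hΔ hf _ hAf _ hNA' e he
    (N₀ := 51) (q := 139) (ℓ := 7) (by norm_num) (by norm_num) (by norm_num) (by decide) (by decide) hN g hg _ hBg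
    (by rw [hA2]; exact Even.zero) hA139 hA7 hW139 hW7 (fun p hp hp51 ↦ ?_) hres
  -- `p ∣ 51 ⇒ p ∈ {3, 17}`, where both curves are multiplicative (`a_p` odd)
  rcases (Nat.Prime.dvd_mul hp : p ∣ 3 * 17 ↔ _).mp hp51 with h | h
  · obtain rfl := (Nat.prime_dvd_prime_iff_eq hp (by norm_num)).mp h
    exact hodd _ _ hW3 hA3
  · obtain rfl := (Nat.prime_dvd_prime_iff_eq hp (by norm_num)).mp h
    exact hodd _ _ hW17 hA17

end MultOneDictionary

end Summit.BirchSwinnertonDyer.BirchSwinnertonDyer.Theorems.SignedMuAtTwo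

end
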